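import Summits.AtomisticToContinuum.HydrodynamicLimit.Theorems.RelayRaceLocalityNearConstantShortTimeHLTiltL2Assembly
import Summits.AtomisticToContinuum.HydrodynamicLimit.Theorems.RelayRaceLocalityNearConstantShortTimeHLReductionPQ
import Summits.AtomisticToContinuum.HydrodynamicLimit.Theorems.RelayRaceLocalityNearConstantShortTimeHLDynamicPQ
import HarnessLib

/-!
# Crux `NearConstantShortTimeHL` (stmt-AtomisticToContinuum-12502), line `small-tilt-domination`, skeleton v18 (lead c8):
# the ENDGAME WITHOUT THE SPEED CAP (skeleton v20) — the crux from the closure K-stubs, the packing cap and Gaussian tails in mean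

Support file (`--supports stmt-AtomisticToContinuum-12502`). Composition of the landed pieces of skeleton v20: level 0 `stub_reductionPQ`
(`…ReductionPQ`) ∘ level 1 `stub_dynamicPQ` (`…DynamicPQ`) through the means-pin dock and the entropy-to-LLN step, with the statics side of the
line closed (`…TiltL2Assembly`). Compared with v18 (`nearConstantShortTimeHL_of_dynamics3 : MomentumClosureTightnessI → EnergyClosureTightnessI →
TrueLawCapsG → crux`) the SPEED CAP along the true law (conjunct (a) of `TrueLawCapsG`, the general-family twin of `MaxSpeedBoundPreShock`,
stmt-9511) is GONE: the equilibrium closure K-stubs condition on the ball-packing cap and the integrated fourth-moment cap only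
(`MomentumClosureTightnessPQ`, `EnergyClosureTightnessPQ`, `…PackQuarticDefs`; they imply the v18 K-stubs), and the true-law input is
`TrueLawCapsPG` — the ball-packing cap (twin of `NoDenseInclusions`, stmt-14425) and Gaussian velocity tails in mean at fixed times (implied by
`TrueLawCapsG`). What stays open: S2⁗, S3⁗ (equilibrium dynamical large deviations) and S4″ (two a-priori bounds along the true law).
References: H.-T. Yau, Lett. Math. Phys. 22 (1991) §2.
-/

noncomputable section

namespace Summit.AtomisticToContinuum.HydrodynamicLimit.Theorems.NearConstantShortTimeHL

open Summit.AtomisticToContinuum.HydrodynamicLimit.Theses.RelayRaceLocality (NearConstantShortTimeHL)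

/-- **THE CRUX FROM ITS FOUR INPUTS WITHOUT THE SPEED CAP** (endgame of skeleton v20): the mesoscale static superlinearity St2′, the
equilibrium momentum / energy closure tightness under the packing and integrated quartic caps (S2⁗, S3⁗), and the packing cap plus Gaussian
velocity tails in mean along the true law (S4″). [cite: Yau1991, §2] -/
theorem nearConstantShortTimeHL_of_inputsPQ : MesoscaleSuperlinearityE → MomentumClosureTightnessPQ → EnergyClosureTightnessPQ → TrueLawCapsPG → NearConstantShortTimeHL :=
  fun hSt2 hS2 hS3 hS4 =>
    stub_entropyToLLN (stub_meansToRelEntropy (meansConverge_of_nearConstantRelEntropy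
      (stub_meansPin stub_ldaGeneralFamilies stub_concentrationGeneralFamilies
        (stub_reductionPQ stub_dynamicPQ hSt2 stub_uniformPressure stub_staticLLN stub_smallTiltDomination hS2 hS3 hS4))))

/-- **THE CRUX FROM THE THREE DYNAMICAL CONJECTURES ALONE, NO SPEED CAP.** With the statics side of the line closed, the hydrodynamic-limit
crux `NearConstantShortTimeHL` follows from the equilibrium momentum / energy closure tightness under the packing and integrated quartic caps
(S2⁗, S3⁗) and, along the true law, ONLY the ball-packing cap and Gaussian velocity tails in mean (S4″) — no quartic and no speed-cap a-priori
input. [cite: Yau1991, §2] -/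
theorem nearConstantShortTimeHL_of_dynamicsPQ :
    MomentumClosureTightnessPQ → EnergyClosureTightnessPQ → TrueLawCapsPG → NearConstantShortTimeHL :=
  nearConstantShortTimeHL_of_inputsPQ
    (mesoscaleSuperlinearityE_of (positionMesoscaleLD_of_densityLD mesoscaleDensityLD_holds) (stub_velocityLD stub_ballGaussianEstimate))

end Summit.AtomisticToContinuum.HydrodynamicLimit.Theorems.NearConstantShortTimeHL

end
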